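import Literature.AlgebraicGeometry.Motives.DiagonalHypersurfaceSmooth
import HarnessLib

/-!
# Hirschfeld's normal forms of the hyperbolic and elliptic quadrics of `ℙ^{2l+3}` are NONSINGULAR:
# `ℋ_{2l+3} = V₊(Σ_{i≤l+1} εᵢ xᵢx_{2l+3−i})` in every characteristic, `ℰ_{2l+3} = V₊(Σ_{i≤l} xᵢx_{2l+3−i} + x_{l+1}² − εx_{l+2}²)`
# for `2 ≠ 0`, `ε ≠ 0` — hence smooth projective of dimension `2l+2`, the standing hypothesis of the `E`-level theory

Topic `Literature/AlgebraicGeometry/Motives`; THEOREMS ONLY (no definition, no instance, no named fact; D-0026).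

Rows g51-#8 (`Motives/SplitQuadricPointCount`) and g51-#11 (`Motives/EllipticQuadricPointCount`) count the points and
compute the zeta functions of the two non-degenerate quadrics of odd projective dimension `2l+3` over `𝔽_q` in
Hirschfeld's canonical forms (*Projective Geometries over Finite Fields*, §5.2 Thm. 5.2.4: `ℋ_{2s−1}`:
`x₀x₁ + x₂x₃ + ⋯`, `ℰ_{2s−1}`: `f(x₀, x₁) + x₂x₃ + ⋯` with `f` an irreducible binary quadratic form; the tree pairs the
coordinate `i` with `2l+3−i` instead of `2i` with `2i+1`, and takes `f = x² − εy²`, `ε` a non-square, in odd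
characteristic), as the schemes `SmoothHypersurface.hypersurface F` (`V₊(F)` with its reduced structure).  The
cohomological (`E`-level) statements of the lane — Betti numbers, Frobenius eigenvalues, Tate's conjecture from the
order of the pole of `Z(X, T)` (`Motives/ZetaFunctionPoleOrderTateConjecture`) — all carry the hypothesis
`IsSmoothProjective (2l+2) X`.  This file discharges it for both quadrics by the Jacobian criterion in the tree's
ideal-theoretic form `SmoothHypersurface.IsNonsingularForm` (Hartshorne I Ex. 5.8: every prime ideal containing `F`
and all `∂F/∂xⱼ` contains every `xⱼ`) and the tree's `IsNonsingularForm.isSmoothHypersurface`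
(`Motives/DiagonalHypersurfaceSmooth`: a nonsingular form of degree `d ≥ 1` in `≥ 3` variables cuts out a smooth
hypersurface of dimension `n`, geometrically irreducible by Krull's Hauptidealsatz, Hartshorne II Example 8.20.2):

* §1 the split form `S = Σ_{i ≤ l+1} εᵢ xᵢ x_{2l+3−i}` (units `εᵢ`): `∂S/∂xᵢ = εᵢ x_{2l+3−i}` and
  `∂S/∂x_{2l+3−i} = εᵢ xᵢ` (`SplitQuadric.pderiv_castLE`, `SplitQuadric.pderiv_rev_castLE`), so
  **`SplitQuadric.isNonsingularForm`** holds over EVERY field (no condition on the characteristic: the involution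
  `i ↦ 2l+3−i` of the `2l+4` coordinates has no fixed point), and **`isSmoothHypersurface_splitQuadric`** ∕
  **`isSmoothProjective_splitQuadric`**: `ℋ_{2l+3}` is a smooth hypersurface of dimension `2l+2` and degree `2`;
* §2 the elliptic form `E = Σ_{i ≤ l} xᵢx_{2l+3−i} + x_{l+1}² − ε x_{l+2}²`: `∂E/∂xᵢ = x_{2l+3−i}`,
  `∂E/∂x_{2l+3−i} = xᵢ` (`i ≤ l`), `∂E/∂x_{l+1} = 2x_{l+1}`, `∂E/∂x_{l+2} = −2ε x_{l+2}`; so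
  **`EllipticQuadric.isNonsingularForm`** for `2 ≠ 0` and `ε ≠ 0` in `k`, **`isSmoothHypersurface_ellipticQuadric`** ∕
  **`isSmoothProjective_ellipticQuadric`**, and over a FINITE field the single hypothesis «`ε` is a non-square» of
  g51-#11 suffices (`two_ne_zero_of_not_isSquare`: in characteristic `2` every element of a finite field is a square,
  Mathlib `FiniteField.isSquare_of_char_two`): **`isSmoothProjective_ellipticQuadric_of_not_isSquare`**.

What is NOT here: characteristic `2` for `ℰ` (Hirschfeld's `f = x² + xy + cy²`); the projective equivalence of an
arbitrary non-degenerate quadric with `ℋ`, `ℰ` or `𝒫` (Thm. 5.2.4 itself; cf. the tree's `Motives/SplitQuadricNormalForm`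
over an algebraically closed field).  HC is not touched.

## References

* [Hirschfeld1998] J. W. P. Hirschfeld, *Projective Geometries over Finite Fields*, 2nd ed., OUP (1998), §5.2
  Thm. 5.2.4 (canonical forms `𝒫_{2s}`, `ℋ_{2s−1}`, `ℰ_{2s−1}`; «non-degenerate» = non-singular).
* [Hartshorne1977] R. Hartshorne, *Algebraic Geometry*, GTM 52 (1977): I Ex. 5.8 (Jacobian criterion for
  projective varieties), II Example 8.20.2, III Example 10.0.3.
* [LidlNiederreiter1996] R. Lidl, H. Niederreiter, *Finite Fields*, 2nd ed. (1996), Thm. 2.2 and §2.1 (squares in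
  `𝔽_{2ᵐ}`).
* Tree: `Motives/HypersurfaceFormsNonsingular` (`IsNonsingularForm`), `Motives/DiagonalHypersurfaceSmooth`
  (`IsNonsingularForm.isSmoothHypersurface`, `IsNonsingularForm.isSmoothProjective`), `Motives/SplitQuadricPointCount`,
  `Motives/EllipticQuadricPointCount` (the forms, written inline exactly as there).

## Provenance

Lane `lit-hodgefound` (summit `HodgeConjecture`, Track 2 foundations library, Layer B: motives ∕ varieties over finite
fields), seat `lit-hodgefound-p29` (literature-prover, generation 52, row g52-#1).
-/

universe u

open MvPolynomial

noncomputable section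

namespace Literature.AlgebraicGeometry.Motives

/-! ### §1 The split form `Σ_{i ≤ l+1} εᵢ xᵢ x_{2l+3−i}` is nonsingular over every field -/

namespace SplitQuadric

variable {k : Type u} [Field k] (l : ℕ) (ε : Fin (l + 2) → kˣ)

/-- `l + 2 ≤ 2l + 2 + 2`: the first half of the coordinates (any proof matches the tree's private one by proof
irrelevance). [folklore] -/
private theorem le_aux' (l : ℕ) : l + 2 ≤ 2 * l + 2 + 2 := by omega

/-- The partner `2l+3−i` of a coordinate `i ≤ l+1` of the first half is never in the first half. [folklore] -/
private theorem rev_castLE_ne_castLE (i j : Fin (l + 2)) :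
    Fin.rev (Fin.castLE (le_aux' l) i) ≠ Fin.castLE (le_aux' l) j := by
  intro h
  have h' := congrArg Fin.val h
  simp only [Fin.val_rev, Fin.val_castLE] at h'
  omega

/-- `∂S/∂xᵢ = εᵢ · x_{2l+3−i}` for the split form `S = Σ_{j ≤ l+1} εⱼ xⱼ x_{2l+3−j}` and `i ≤ l+1`.
[cite: Hartshorne1977, I Ex. 5.8] [cite: Hirschfeld1998, §5.2 Thm. 5.2.4] -/
theorem pderiv_castLE (i : Fin (l + 2)) :
    pderiv (Fin.castLE (le_aux' l) i)
        (∑ j : Fin (l + 2), C (ε j : k) * X (Fin.castLE (le_aux' l) j) * X (Fin.rev (Fin.castLE (le_aux' l) j)) :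
          MvPolynomial (Fin (2 * l + 2 + 2)) k) =
      C (ε i : k) * X (Fin.rev (Fin.castLE (le_aux' l) i)) := by
  rw [map_sum, Finset.sum_eq_single i]
  · rw [pderiv_mul, mul_assoc, pderiv_C_mul, pderiv_X_self, pderiv_X_of_ne (rev_castLE_ne_castLE l i i)]
    simp
  · intro j _ hji
    rw [pderiv_mul, mul_assoc, pderiv_C_mul,
      pderiv_X_of_ne ((Fin.castLE_injective (le_aux' l)).ne hji), pderiv_X_of_ne (rev_castLE_ne_castLE l j i)]
    simp
  · intro hi
    exact absurd (Finset.mem_univ i) hi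

/-- `∂S/∂x_{2l+3−i} = εᵢ · xᵢ` for the split form and `i ≤ l+1`. [cite: Hartshorne1977, I Ex. 5.8]
[cite: Hirschfeld1998, §5.2 Thm. 5.2.4] -/
theorem pderiv_rev_castLE (i : Fin (l + 2)) :
    pderiv (Fin.rev (Fin.castLE (le_aux' l) i))
        (∑ j : Fin (l + 2), C (ε j : k) * X (Fin.castLE (le_aux' l) j) * X (Fin.rev (Fin.castLE (le_aux' l) j)) :
          MvPolynomial (Fin (2 * l + 2 + 2)) k) =
      C (ε i : k) * X (Fin.castLE (le_aux' l) i) := by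
  rw [map_sum, Finset.sum_eq_single i]
  · rw [pderiv_mul, mul_assoc, pderiv_C_mul, pderiv_X_of_ne (rev_castLE_ne_castLE l i i).symm, pderiv_X_self]
    simp
  · intro j _ hji
    rw [pderiv_mul, mul_assoc, pderiv_C_mul, pderiv_X_of_ne (rev_castLE_ne_castLE l i j).symm,
      pderiv_X_of_ne (Fin.rev_injective.ne ((Fin.castLE_injective (le_aux' l)).ne hji))]
    simp
  · intro hi
    exact absurd (Finset.mem_univ i) hi

/-- **The split form `Σ_{i ≤ l+1} εᵢ xᵢ x_{2l+3−i}` (units `εᵢ`) is nonsingular, over every field**: a prime ideal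
containing the partials `εᵢ x_{2l+3−i}` and `εᵢ xᵢ` contains every coordinate — the Jacobian criterion for the
hyperbolic quadric `ℋ_{2l+3}`, with no condition on the characteristic. [cite: Hartshorne1977, I Ex. 5.8]
[cite: Hirschfeld1998, §5.2 Thm. 5.2.4] -/
theorem isNonsingularForm :
    SmoothHypersurface.IsNonsingularForm k
      (∑ j : Fin (l + 2), C (ε j : k) * X (Fin.castLE (le_aux' l) j) * X (Fin.rev (Fin.castLE (le_aux' l) j)) :
        MvPolynomial (Fin (2 * l + 2 + 2)) k) := by
  intro 𝔭 _ _ hder m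
  by_cases hm : (m : ℕ) ≤ l + 1
  · -- `m = i` is in the first half: use `∂S/∂x_{2l+3−i} = εᵢ xᵢ`
    set i : Fin (l + 2) := ⟨m, by omega⟩ with hi
    have hmi : m = Fin.castLE (le_aux' l) i := Fin.ext (by simp [hi])
    have h := hder (Fin.rev (Fin.castLE (le_aux' l) i))
    rw [pderiv_rev_castLE, Ideal.unit_mul_mem_iff_mem 𝔭 ((ε i).isUnit.map C)] at h
    rwa [hmi]
  · -- `m = 2l+3−i` is in the second half: use `∂S/∂xᵢ = εᵢ x_{2l+3−i}`
    set i : Fin (l + 2) := ⟨2 * l + 3 - m, by omega⟩ with hi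
    have hmi : m = Fin.rev (Fin.castLE (le_aux' l) i) := Fin.ext (by simp [hi, Fin.val_rev]; omega)
    have h := hder (Fin.castLE (le_aux' l) i)
    rw [pderiv_castLE, Ideal.unit_mul_mem_iff_mem 𝔭 ((ε i).isUnit.map C)] at h
    rwa [hmi]

end SplitQuadric

section Split

open SmoothHypersurface

variable {k : Type u} [Field k] (l : ℕ) (ε : Fin (l + 2) → kˣ)

/-- **The hyperbolic quadric `ℋ_{2l+3} = V₊(Σ_{i ≤ l+1} εᵢ xᵢ x_{2l+3−i}) ⊂ ℙ^{2l+3}` is a smooth hypersurface of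
dimension `2l+2` and degree `2`, over every field** (Jacobian criterion + Krull for geometric irreducibility; the
tree's `IsNonsingularForm.isSmoothHypersurface`). [cite: Hirschfeld1998, §5.2 Thm. 5.2.4]
[cite: Hartshorne1977, I Ex. 5.8 and II Example 8.20.2] -/
theorem isSmoothHypersurface_splitQuadric :
    IsSmoothHypersurface (2 * l + 2) 2
      (hypersurface (∑ j : Fin (l + 2), C (ε j : k) * X (Fin.castLE (SplitQuadric.le_aux' l) j) *
        X (Fin.rev (Fin.castLE (SplitQuadric.le_aux' l) j)) : MvPolynomial (Fin (2 * l + 2 + 2)) k)) :=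
  (SplitQuadric.isNonsingularForm l ε).isSmoothHypersurface (n := 2 * l + 2) (by omega) (by norm_num)
    (IsHomogeneous.sum _ _ 2 fun j _ =>
      ((isHomogeneous_C _ (ε j : k)).mul (isHomogeneous_X k _)).mul (isHomogeneous_X k _))

/-- The hyperbolic quadric `ℋ_{2l+3}` is smooth projective of dimension `2l+2` over every field — the hypothesis
`IsSmoothProjective (2l+2) X` of the tree's Weil-cohomology machinery. [cite: Hirschfeld1998, §5.2 Thm. 5.2.4]
[cite: Hartshorne1977, I Ex. 5.8 and III Example 10.0.3] -/
theorem isSmoothProjective_splitQuadric :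
    IsSmoothProjective (2 * l + 2)
      (hypersurface (∑ j : Fin (l + 2), C (ε j : k) * X (Fin.castLE (SplitQuadric.le_aux' l) j) *
        X (Fin.rev (Fin.castLE (SplitQuadric.le_aux' l) j)) : MvPolynomial (Fin (2 * l + 2 + 2)) k)) :=
  (isSmoothHypersurface_splitQuadric l ε).1

/-- The hyperbolic quadric is smooth projective of dimension `2l+2` AND cut out by its form in `ℙ^{2l+3}` (the
tree's `IsHypersurfaceCutOutBy`). [cite: Hartshorne1977, I Ex. 5.8 and III Example 10.0.3] -/
theorem isSmoothProjective_and_isHypersurfaceCutOutBy_splitQuadric :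
    IsSmoothProjective (2 * l + 2)
        (hypersurface (∑ j : Fin (l + 2), C (ε j : k) * X (Fin.castLE (SplitQuadric.le_aux' l) j) *
          X (Fin.rev (Fin.castLE (SplitQuadric.le_aux' l) j)) : MvPolynomial (Fin (2 * l + 2 + 2)) k)) ∧
      IsHypersurfaceCutOutBy (2 * l + 2 + 1)
        (∑ j : Fin (l + 2), C (ε j : k) * X (Fin.castLE (SplitQuadric.le_aux' l) j) *
          X (Fin.rev (Fin.castLE (SplitQuadric.le_aux' l) j)) : MvPolynomial (Fin (2 * l + 2 + 2)) k)
        (hypersurface (∑ j : Fin (l + 2), C (ε j : k) * X (Fin.castLE (SplitQuadric.le_aux' l) j) *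
          X (Fin.rev (Fin.castLE (SplitQuadric.le_aux' l) j)) : MvPolynomial (Fin (2 * l + 2 + 2)) k)) :=
  (SplitQuadric.isNonsingularForm l ε).isSmoothProjective (n := 2 * l + 2) (by omega) (by norm_num)
    (IsHomogeneous.sum _ _ 2 fun j _ =>
      ((isHomogeneous_C _ (ε j : k)).mul (isHomogeneous_X k _)).mul (isHomogeneous_X k _))

end Split

/-! ### §2 The elliptic form `Σ_{i ≤ l} xᵢx_{2l+3−i} + x_{l+1}² − ε x_{l+2}²` is nonsingular for `2 ≠ 0`, `ε ≠ 0` -/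

namespace EllipticQuadric

variable {k : Type u} [Field k] (l : ℕ) (ε : k)

/-- `l + 1 ≤ 2l + 2 + 2` (matches the tree's private proof by proof irrelevance). [folklore] -/
private theorem le₁' (l : ℕ) : l + 1 ≤ 2 * l + 2 + 2 := by omega

/-- The middle coordinate `l + 1`. [folklore] -/
private theorem lt₁' (l : ℕ) : l + 1 < 2 * l + 2 + 2 := by omega

/-- The middle coordinate `l + 2`. [folklore] -/
private theorem lt₂' (l : ℕ) : l + 2 < 2 * l + 2 + 2 := by omega

/-- The partner `2l+3−i` of a hyperbolic coordinate `i ≤ l` is never a hyperbolic coordinate `j ≤ l`. [folklore] -/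
private theorem rev_castLE_ne_castLE (i j : Fin (l + 1)) :
    Fin.rev (Fin.castLE (le₁' l) i) ≠ Fin.castLE (le₁' l) j := by
  intro h
  have h' := congrArg Fin.val h
  simp only [Fin.val_rev, Fin.val_castLE] at h'
  omega

/-- The middle coordinate `l+1` is not a hyperbolic coordinate `i ≤ l`. [folklore] -/
private theorem mid₁_ne_castLE (i : Fin (l + 1)) : (⟨l + 1, lt₁' l⟩ : Fin (2 * l + 2 + 2)) ≠ Fin.castLE (le₁' l) i := by
  intro h
  have h' := congrArg Fin.val h
  simp only [Fin.val_castLE] at h'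
  omega

/-- The middle coordinate `l+1` is not a partner `2l+3−i`, `i ≤ l`. [folklore] -/
private theorem mid₁_ne_rev_castLE (i : Fin (l + 1)) :
    (⟨l + 1, lt₁' l⟩ : Fin (2 * l + 2 + 2)) ≠ Fin.rev (Fin.castLE (le₁' l) i) := by
  intro h
  have h' := congrArg Fin.val h
  simp only [Fin.val_rev, Fin.val_castLE] at h'
  omega

/-- The middle coordinate `l+2` is not a hyperbolic coordinate `i ≤ l`. [folklore] -/
private theorem mid₂_ne_castLE (i : Fin (l + 1)) : (⟨l + 2, lt₂' l⟩ : Fin (2 * l + 2 + 2)) ≠ Fin.castLE (le₁' l) i := by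
  intro h
  have h' := congrArg Fin.val h
  simp only [Fin.val_castLE] at h'
  omega

/-- The middle coordinate `l+2` is not a partner `2l+3−i`, `i ≤ l`. [folklore] -/
private theorem mid₂_ne_rev_castLE (i : Fin (l + 1)) :
    (⟨l + 2, lt₂' l⟩ : Fin (2 * l + 2 + 2)) ≠ Fin.rev (Fin.castLE (le₁' l) i) := by
  intro h
  have h' := congrArg Fin.val h
  simp only [Fin.val_rev, Fin.val_castLE] at h'
  omega

/-- The two middle coordinates are distinct. [folklore] -/
private theorem mid₁_ne_mid₂ : (⟨l + 1, lt₁' l⟩ : Fin (2 * l + 2 + 2)) ≠ ⟨l + 2, lt₂' l⟩ := by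
  intro h
  have h' := congrArg Fin.val h
  simp only at h'
  omega

/-- The partial derivative of the hyperbolic part `Σ_{j ≤ l} xⱼ x_{2l+3−j}` in a hyperbolic coordinate `i ≤ l` is
`x_{2l+3−i}`. [cite: Hartshorne1977, I Ex. 5.8] -/
theorem pderiv_castLE_sum (i : Fin (l + 1)) :
    pderiv (Fin.castLE (le₁' l) i)
        (∑ j : Fin (l + 1), X (Fin.castLE (le₁' l) j) * X (Fin.rev (Fin.castLE (le₁' l) j)) :
          MvPolynomial (Fin (2 * l + 2 + 2)) k) =
      X (Fin.rev (Fin.castLE (le₁' l) i)) := by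
  rw [map_sum, Finset.sum_eq_single i]
  · rw [pderiv_mul, pderiv_X_self, pderiv_X_of_ne (rev_castLE_ne_castLE l i i)]
    simp
  · intro j _ hji
    rw [pderiv_mul, pderiv_X_of_ne ((Fin.castLE_injective (le₁' l)).ne hji),
      pderiv_X_of_ne (rev_castLE_ne_castLE l j i)]
    simp
  · intro hi
    exact absurd (Finset.mem_univ i) hi

/-- The partial derivative of the hyperbolic part in a partner coordinate `2l+3−i`, `i ≤ l`, is `xᵢ`.
[cite: Hartshorne1977, I Ex. 5.8] -/
theorem pderiv_rev_castLE_sum (i : Fin (l + 1)) :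
    pderiv (Fin.rev (Fin.castLE (le₁' l) i))
        (∑ j : Fin (l + 1), X (Fin.castLE (le₁' l) j) * X (Fin.rev (Fin.castLE (le₁' l) j)) :
          MvPolynomial (Fin (2 * l + 2 + 2)) k) =
      X (Fin.castLE (le₁' l) i) := by
  rw [map_sum, Finset.sum_eq_single i]
  · rw [pderiv_mul, pderiv_X_of_ne (rev_castLE_ne_castLE l i i).symm, pderiv_X_self]
    simp
  · intro j _ hji
    rw [pderiv_mul, pderiv_X_of_ne (rev_castLE_ne_castLE l i j).symm,
      pderiv_X_of_ne (Fin.rev_injective.ne ((Fin.castLE_injective (le₁' l)).ne hji))]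
    simp
  · intro hi
    exact absurd (Finset.mem_univ i) hi

/-- The hyperbolic part does not involve the middle coordinate `l+1`. [cite: Hartshorne1977, I Ex. 5.8] -/
theorem pderiv_mid₁_sum :
    pderiv (⟨l + 1, lt₁' l⟩ : Fin (2 * l + 2 + 2))
        (∑ j : Fin (l + 1), X (Fin.castLE (le₁' l) j) * X (Fin.rev (Fin.castLE (le₁' l) j)) :
          MvPolynomial (Fin (2 * l + 2 + 2)) k) = 0 := by
  rw [map_sum]
  refine Finset.sum_eq_zero fun j _ => ?_
  rw [pderiv_mul, pderiv_X_of_ne (mid₁_ne_castLE l j).symm, pderiv_X_of_ne (mid₁_ne_rev_castLE l j).symm]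
  simp

/-- The hyperbolic part does not involve the middle coordinate `l+2`. [cite: Hartshorne1977, I Ex. 5.8] -/
theorem pderiv_mid₂_sum :
    pderiv (⟨l + 2, lt₂' l⟩ : Fin (2 * l + 2 + 2))
        (∑ j : Fin (l + 1), X (Fin.castLE (le₁' l) j) * X (Fin.rev (Fin.castLE (le₁' l) j)) :
          MvPolynomial (Fin (2 * l + 2 + 2)) k) = 0 := by
  rw [map_sum]
  refine Finset.sum_eq_zero fun j _ => ?_
  rw [pderiv_mul, pderiv_X_of_ne (mid₂_ne_castLE l j).symm, pderiv_X_of_ne (mid₂_ne_rev_castLE l j).symm]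
  simp

/-- **`∂E/∂xᵢ = x_{2l+3−i}`** (`i ≤ l`) for the elliptic form `E = Σ_{j ≤ l} xⱼx_{2l+3−j} + x_{l+1}² − ε x_{l+2}²`.
[cite: Hartshorne1977, I Ex. 5.8] [cite: Hirschfeld1998, §5.2 Thm. 5.2.4] -/
theorem pderiv_castLE (i : Fin (l + 1)) :
    pderiv (Fin.castLE (le₁' l) i)
        ((∑ j : Fin (l + 1), X (Fin.castLE (le₁' l) j) * X (Fin.rev (Fin.castLE (le₁' l) j))) +
          X ⟨l + 1, lt₁' l⟩ ^ 2 - C ε * X ⟨l + 2, lt₂' l⟩ ^ 2 : MvPolynomial (Fin (2 * l + 2 + 2)) k) =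
      X (Fin.rev (Fin.castLE (le₁' l) i)) := by
  rw [map_sub, map_add, pderiv_castLE_sum, pderiv_C_mul, pderiv_pow, pderiv_pow,
    pderiv_X_of_ne (mid₁_ne_castLE l i), pderiv_X_of_ne (mid₂_ne_castLE l i)]
  simp

/-- **`∂E/∂x_{2l+3−i} = xᵢ`** (`i ≤ l`) for the elliptic form. [cite: Hartshorne1977, I Ex. 5.8]
[cite: Hirschfeld1998, §5.2 Thm. 5.2.4] -/
theorem pderiv_rev_castLE (i : Fin (l + 1)) :
    pderiv (Fin.rev (Fin.castLE (le₁' l) i))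
        ((∑ j : Fin (l + 1), X (Fin.castLE (le₁' l) j) * X (Fin.rev (Fin.castLE (le₁' l) j))) +
          X ⟨l + 1, lt₁' l⟩ ^ 2 - C ε * X ⟨l + 2, lt₂' l⟩ ^ 2 : MvPolynomial (Fin (2 * l + 2 + 2)) k) =
      X (Fin.castLE (le₁' l) i) := by
  rw [map_sub, map_add, pderiv_rev_castLE_sum, pderiv_C_mul, pderiv_pow, pderiv_pow,
    pderiv_X_of_ne (mid₁_ne_rev_castLE l i), pderiv_X_of_ne (mid₂_ne_rev_castLE l i)]
  simp

/-- **`∂E/∂x_{l+1} = 2x_{l+1}`** for the elliptic form. [cite: Hartshorne1977, I Ex. 5.8]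
[cite: Hirschfeld1998, §5.2 Thm. 5.2.4] -/
theorem pderiv_mid₁ :
    pderiv (⟨l + 1, lt₁' l⟩ : Fin (2 * l + 2 + 2))
        ((∑ j : Fin (l + 1), X (Fin.castLE (le₁' l) j) * X (Fin.rev (Fin.castLE (le₁' l) j))) +
          X ⟨l + 1, lt₁' l⟩ ^ 2 - C ε * X ⟨l + 2, lt₂' l⟩ ^ 2 : MvPolynomial (Fin (2 * l + 2 + 2)) k) =
      C 2 * X ⟨l + 1, lt₁' l⟩ := by
  rw [map_sub, map_add, pderiv_mid₁_sum, pderiv_C_mul, pderiv_pow, pderiv_pow, pderiv_X_self,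
    pderiv_X_of_ne (mid₁_ne_mid₂ l).symm, map_ofNat]
  simp

/-- **`∂E/∂x_{l+2} = −2ε x_{l+2}`** for the elliptic form. [cite: Hartshorne1977, I Ex. 5.8]
[cite: Hirschfeld1998, §5.2 Thm. 5.2.4] -/
theorem pderiv_mid₂ :
    pderiv (⟨l + 2, lt₂' l⟩ : Fin (2 * l + 2 + 2))
        ((∑ j : Fin (l + 1), X (Fin.castLE (le₁' l) j) * X (Fin.rev (Fin.castLE (le₁' l) j))) +
          X ⟨l + 1, lt₁' l⟩ ^ 2 - C ε * X ⟨l + 2, lt₂' l⟩ ^ 2 : MvPolynomial (Fin (2 * l + 2 + 2)) k) =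
      C (-(2 * ε)) * X ⟨l + 2, lt₂' l⟩ := by
  rw [map_sub, map_add, pderiv_mid₂_sum, pderiv_C_mul, pderiv_pow, pderiv_pow, pderiv_X_self,
    pderiv_X_of_ne (mid₁_ne_mid₂ l), map_neg, map_mul, map_ofNat]
  simp only [zero_add, mul_zero, mul_one, zero_sub, Nat.cast_ofNat]
  ring

/-- **The elliptic form `Σ_{i ≤ l} xᵢx_{2l+3−i} + x_{l+1}² − ε x_{l+2}²` is nonsingular when `2 ≠ 0` and `ε ≠ 0`
in `k`**: a prime ideal containing the partials `x_{2l+3−i}`, `xᵢ` (`i ≤ l`), `2x_{l+1}` and `−2εx_{l+2}` contains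
every coordinate — the Jacobian criterion for the elliptic quadric `ℰ_{2l+3}` in odd characteristic.
[cite: Hartshorne1977, I Ex. 5.8] [cite: Hirschfeld1998, §5.2 Thm. 5.2.4] -/
theorem isNonsingularForm (h2 : (2 : k) ≠ 0) (hε : ε ≠ 0) :
    SmoothHypersurface.IsNonsingularForm k
      ((∑ j : Fin (l + 1), X (Fin.castLE (le₁' l) j) * X (Fin.rev (Fin.castLE (le₁' l) j))) +
        X ⟨l + 1, lt₁' l⟩ ^ 2 - C ε * X ⟨l + 2, lt₂' l⟩ ^ 2 : MvPolynomial (Fin (2 * l + 2 + 2)) k) := by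
  intro 𝔭 _ _ hder m
  by_cases hm : (m : ℕ) ≤ l
  · -- a hyperbolic coordinate `i ≤ l`: use `∂E/∂x_{2l+3−i} = xᵢ`
    set i : Fin (l + 1) := ⟨m, by omega⟩ with hi
    have hmi : m = Fin.castLE (le₁' l) i := Fin.ext (by simp [hi])
    have h := hder (Fin.rev (Fin.castLE (le₁' l) i))
    rw [pderiv_rev_castLE] at h
    rwa [hmi]
  by_cases hm₁ : (m : ℕ) = l + 1
  · -- the middle coordinate `l+1`: `∂E/∂x_{l+1} = 2x_{l+1}`, `2` a unit
    have hmi : m = ⟨l + 1, lt₁' l⟩ := Fin.ext hm₁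
    have h := hder ⟨l + 1, lt₁' l⟩
    rw [pderiv_mid₁, Ideal.unit_mul_mem_iff_mem 𝔭 ((IsUnit.mk0 _ h2).map C)] at h
    rwa [hmi]
  by_cases hm₂ : (m : ℕ) = l + 2
  · -- the middle coordinate `l+2`: `∂E/∂x_{l+2} = −2εx_{l+2}`, `−2ε` a unit
    have hmi : m = ⟨l + 2, lt₂' l⟩ := Fin.ext hm₂
    have h := hder ⟨l + 2, lt₂' l⟩
    rw [pderiv_mid₂, Ideal.unit_mul_mem_iff_mem 𝔭
      ((IsUnit.mk0 _ (neg_ne_zero.mpr (mul_ne_zero h2 hε))).map C)] at h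
    rwa [hmi]
  · -- a partner coordinate `2l+3−i`, `i ≤ l`: use `∂E/∂xᵢ = x_{2l+3−i}`
    set i : Fin (l + 1) := ⟨2 * l + 3 - m, by omega⟩ with hi
    have hmi : m = Fin.rev (Fin.castLE (le₁' l) i) := Fin.ext (by simp [hi, Fin.val_rev]; omega)
    have h := hder (Fin.castLE (le₁' l) i)
    rw [pderiv_castLE] at h
    rwa [hmi]

/-- The elliptic form is homogeneous of degree `2` (the tree's `EllipticQuadric.isHomogeneous`, restated over the
local index proofs for use below; any proofs of the index bounds give the same polynomial). [cite: Hirschfeld1998, §5.2 Thm. 5.2.4] -/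
private theorem isHomogeneous' :
    ((∑ j : Fin (l + 1), X (Fin.castLE (le₁' l) j) * X (Fin.rev (Fin.castLE (le₁' l) j))) +
        X ⟨l + 1, lt₁' l⟩ ^ 2 - C ε * X ⟨l + 2, lt₂' l⟩ ^ 2 : MvPolynomial (Fin (2 * l + 2 + 2)) k).IsHomogeneous 2 := by
  refine ((IsHomogeneous.sum _ _ 2 fun i _ => ?_).add (isHomogeneous_X_pow _ 2)).sub
    ((isHomogeneous_X_pow _ 2).C_mul ε)
  exact (isHomogeneous_X k (Fin.castLE (le₁' l) i)).mul (isHomogeneous_X k (Fin.rev (Fin.castLE (le₁' l) i)))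

end EllipticQuadric

section Elliptic

open SmoothHypersurface

variable {k : Type u} [Field k] (l : ℕ) {ε : k}

/-- **The elliptic quadric `ℰ_{2l+3} = V₊(Σ_{i ≤ l} xᵢx_{2l+3−i} + x_{l+1}² − ε x_{l+2}²) ⊂ ℙ^{2l+3}` is a smooth
hypersurface of dimension `2l+2` and degree `2`** whenever `2 ≠ 0` and `ε ≠ 0` in `k` (Jacobian criterion + Krull
for geometric irreducibility). [cite: Hirschfeld1998, §5.2 Thm. 5.2.4] [cite: Hartshorne1977, I Ex. 5.8 and II Example 8.20.2] -/
theorem isSmoothHypersurface_ellipticQuadric (h2 : (2 : k) ≠ 0) (hε : ε ≠ 0) :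
    IsSmoothHypersurface (2 * l + 2) 2
      (hypersurface ((∑ j : Fin (l + 1), X (Fin.castLE (EllipticQuadric.le₁' l) j) *
          X (Fin.rev (Fin.castLE (EllipticQuadric.le₁' l) j))) +
        X ⟨l + 1, EllipticQuadric.lt₁' l⟩ ^ 2 - C ε * X ⟨l + 2, EllipticQuadric.lt₂' l⟩ ^ 2 :
          MvPolynomial (Fin (2 * l + 2 + 2)) k)) :=
  (EllipticQuadric.isNonsingularForm l ε h2 hε).isSmoothHypersurface (n := 2 * l + 2) (by omega) (by norm_num)
    (EllipticQuadric.isHomogeneous' l ε)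

/-- The elliptic quadric `ℰ_{2l+3}` is smooth projective of dimension `2l+2` (`2 ≠ 0`, `ε ≠ 0` in `k`).
[cite: Hirschfeld1998, §5.2 Thm. 5.2.4] [cite: Hartshorne1977, I Ex. 5.8 and III Example 10.0.3] -/
theorem isSmoothProjective_ellipticQuadric (h2 : (2 : k) ≠ 0) (hε : ε ≠ 0) :
    IsSmoothProjective (2 * l + 2)
      (hypersurface ((∑ j : Fin (l + 1), X (Fin.castLE (EllipticQuadric.le₁' l) j) *
          X (Fin.rev (Fin.castLE (EllipticQuadric.le₁' l) j))) +
        X ⟨l + 1, EllipticQuadric.lt₁' l⟩ ^ 2 - C ε * X ⟨l + 2, EllipticQuadric.lt₂' l⟩ ^ 2 :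
          MvPolynomial (Fin (2 * l + 2 + 2)) k)) :=
  (isSmoothHypersurface_ellipticQuadric l h2 hε).1

/-- The elliptic quadric is smooth projective of dimension `2l+2` AND cut out by its form in `ℙ^{2l+3}` (`2 ≠ 0`,
`ε ≠ 0`). [cite: Hartshorne1977, I Ex. 5.8 and III Example 10.0.3] -/
theorem isSmoothProjective_and_isHypersurfaceCutOutBy_ellipticQuadric (h2 : (2 : k) ≠ 0) (hε : ε ≠ 0) :
    IsSmoothProjective (2 * l + 2)
        (hypersurface ((∑ j : Fin (l + 1), X (Fin.castLE (EllipticQuadric.le₁' l) j) *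
            X (Fin.rev (Fin.castLE (EllipticQuadric.le₁' l) j))) +
          X ⟨l + 1, EllipticQuadric.lt₁' l⟩ ^ 2 - C ε * X ⟨l + 2, EllipticQuadric.lt₂' l⟩ ^ 2 :
            MvPolynomial (Fin (2 * l + 2 + 2)) k)) ∧
      IsHypersurfaceCutOutBy (2 * l + 2 + 1)
        ((∑ j : Fin (l + 1), X (Fin.castLE (EllipticQuadric.le₁' l) j) *
            X (Fin.rev (Fin.castLE (EllipticQuadric.le₁' l) j))) +
          X ⟨l + 1, EllipticQuadric.lt₁' l⟩ ^ 2 - C ε * X ⟨l + 2, EllipticQuadric.lt₂' l⟩ ^ 2 :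
            MvPolynomial (Fin (2 * l + 2 + 2)) k)
        (hypersurface ((∑ j : Fin (l + 1), X (Fin.castLE (EllipticQuadric.le₁' l) j) *
            X (Fin.rev (Fin.castLE (EllipticQuadric.le₁' l) j))) +
          X ⟨l + 1, EllipticQuadric.lt₁' l⟩ ^ 2 - C ε * X ⟨l + 2, EllipticQuadric.lt₂' l⟩ ^ 2 :
            MvPolynomial (Fin (2 * l + 2 + 2)) k)) :=
  (EllipticQuadric.isNonsingularForm l ε h2 hε).isSmoothProjective (n := 2 * l + 2) (by omega) (by norm_num)
    (EllipticQuadric.isHomogeneous' l ε)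

/-! #### Over a finite field: «`ε` a non-square» suffices -/

/-- **In a finite field containing a non-square, `2 ≠ 0`**: in characteristic `2` the Frobenius `x ↦ x²` of a finite
field is onto, so every element is a square (Mathlib `FiniteField.isSquare_of_char_two`).
[cite: LidlNiederreiter1996, Thm. 2.2 and §2.1] -/
theorem two_ne_zero_of_not_isSquare [Finite k] (hε : ¬IsSquare ε) : (2 : k) ≠ 0 := by
  intro h2
  refine hε (FiniteField.isSquare_of_char_two ?_ ε)
  have h := ringChar.dvd (R := k) (x := 2) (by exact_mod_cast h2)
  rcases (Nat.dvd_prime Nat.prime_two).mp h with h1 | h1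
  · exact absurd h1 (CharP.ringChar_ne_one (R := k))
  · exact h1

/-- A non-square is non-zero (`0 = 0·0`). [folklore] -/
private theorem ne_zero_of_not_isSquare (hε : ¬IsSquare ε) : ε ≠ 0 := by
  rintro rfl
  exact hε ⟨0, (mul_zero 0).symm⟩

/-- **Over a finite field `𝔽_q`, the elliptic quadric `ℰ_{2l+3}` of `Motives/EllipticQuadricPointCount` (`ε` a
non-square) is a smooth hypersurface of dimension `2l+2` and degree `2`** — its single standing hypothesis
`¬IsSquare ε` forces `q` odd and `ε ≠ 0`. [cite: Hirschfeld1998, §5.2 Thm. 5.2.4]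
[cite: Hartshorne1977, I Ex. 5.8 and II Example 8.20.2] -/
theorem isSmoothHypersurface_ellipticQuadric_of_not_isSquare [Finite k] (hε : ¬IsSquare ε) :
    IsSmoothHypersurface (2 * l + 2) 2
      (hypersurface ((∑ j : Fin (l + 1), X (Fin.castLE (EllipticQuadric.le₁' l) j) *
          X (Fin.rev (Fin.castLE (EllipticQuadric.le₁' l) j))) +
        X ⟨l + 1, EllipticQuadric.lt₁' l⟩ ^ 2 - C ε * X ⟨l + 2, EllipticQuadric.lt₂' l⟩ ^ 2 :
          MvPolynomial (Fin (2 * l + 2 + 2)) k)) :=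
  isSmoothHypersurface_ellipticQuadric l (two_ne_zero_of_not_isSquare hε) (ne_zero_of_not_isSquare hε)

/-- Over `𝔽_q` with `ε` a non-square: the elliptic quadric is smooth projective of dimension `2l+2` — the hypothesis
`IsSmoothProjective (2l+2) ℰ` of the `E`-level statements. [cite: Hirschfeld1998, §5.2 Thm. 5.2.4]
[cite: Hartshorne1977, I Ex. 5.8 and III Example 10.0.3] -/
theorem isSmoothProjective_ellipticQuadric_of_not_isSquare [Finite k] (hε : ¬IsSquare ε) :
    IsSmoothProjective (2 * l + 2)
      (hypersurface ((∑ j : Fin (l + 1), X (Fin.castLE (EllipticQuadric.le₁' l) j) *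
          X (Fin.rev (Fin.castLE (EllipticQuadric.le₁' l) j))) +
        X ⟨l + 1, EllipticQuadric.lt₁' l⟩ ^ 2 - C ε * X ⟨l + 2, EllipticQuadric.lt₂' l⟩ ^ 2 :
          MvPolynomial (Fin (2 * l + 2 + 2)) k)) :=
  (isSmoothHypersurface_ellipticQuadric_of_not_isSquare l hε).1

end Elliptic

end Literature.AlgebraicGeometry.Motives

end
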